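import Literature.Topology.FourManifolds.SurfaceGroupAmalgam
import Literature.GroupTheory.CombinatorialGroupTheory.SurfaceRelatorPrimitive
import Literature.GroupTheory.CombinatorialGroupTheory.FreeGroupAmalgamSeparation
import Literature.GroupTheory.CombinatorialGroupTheory.FreeGroupCentralizers
import Mathlib.GroupTheory.PushoutI
import HarnessLib

/-!
# Attaching a handle: `F⟨a₁,…,b_{h+1}⟩` as the amalgam `F⟨a₁,…,b_h⟩ *_ℤ F⟨c, a, b⟩` along `r_h = c`

Topic `Literature/GroupTheory/CombinatorialGroupTheory`.  The free group of the once-bordered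
surface of genus `h + 1` splits along the curve separating the last handle:
`π₁(Σ_{h+1,1}) = π₁(Σ_{h,1}) *_ℤ π₁(Σ_{1,2})`, i.e.
`F⟨a₁, …, b_{h+1}⟩ ≅ F⟨a₁, …, b_h⟩ *_{r_h = c} F⟨c, a, b⟩` with `r_h = ∏_{i ≤ h} [aᵢ, bᵢ]` and
`F⟨c, a, b⟩` free of rank three (Seifert–van Kampen; Lyndon–Schupp I.7, Baumslag 1962 §4).  As in
`SurfaceGroupPushout.lean` we realise this with Mathlib's `Monoid.PushoutI`:

* `HandleFactorGen h b`, `handleAmalgamElt`, `handleAmalgamHom`, `HandleAmalgam h` — the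
  `Bool`-indexed data (`false ↦ (F_{2h}, ℤ ↦ r_h)`, `true ↦ (F⟨c,a,b⟩ = FreeGroup (Option _), ℤ ↦ c)`);
* `handleAmalgamHom_injective` (`h ≥ 1`);
* `exists_freeGroup_mulEquiv_handleAmalgam` — **`F_{2h+2} ≃* F_{2h} *_ℤ F₃`** carrying the first
  `h` handles to the factor `false` and the last handle to `a, b` in the factor `true` (the
  pushout of `A ← ℤ → ℤ * B` is `A * B`, via the tree's `freeGroup_exists_mulEquiv_of_coproduct`);
* `handleAmalgam_commutator_ne_one` — in each factor, elements outside the amalgamated `ℤ` do not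
  commute with its generator (input `hcen` of the combination lemma).

## References

* G. Baumslag, *On generalised free products*, Math. Z. 78 (1962), §4. [Baumslag1962]
* R. C. Lyndon, P. E. Schupp, *Combinatorial Group Theory*, Springer (1977); Classics in
  Mathematics (2001), Ch. I §7. [LyndonSchupp2001]
-/

noncomputable section

namespace Literature.GroupTheory.CombinatorialGroupTheory

open Literature.Topology.FourManifolds Monoid

/-! ### The amalgam data -/

/-- Generators of the factor `b`: the `2h` surface generators for `false`; `c` (`none`) and
`a, b` (`some _`) for `true`. [cite: LyndonSchupp2001, Ch. I §7] -/
abbrev HandleFactorGen (h : ℕ) (b : Bool) : Type :=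
  Bool.rec (motive := fun _ => Type) (surfaceGen h) (Option (surfaceGen 1)) b

/-- The amalgamated elements: `r_h` in `F_{2h}`, the letter `c` in `F⟨c, a, b⟩`.
[cite: LyndonSchupp2001, Ch. I §7] -/
def handleAmalgamElt (h : ℕ) : (b : Bool) → FreeGroup (HandleFactorGen h b)
  | false => surfaceRelator h
  | true => FreeGroup.of none

/-- The structure maps `ℤ → F_{2h}`, `1 ↦ r_h`, and `ℤ → F⟨c,a,b⟩`, `1 ↦ c`.
[cite: LyndonSchupp2001, Ch. I §7] -/
def handleAmalgamHom (h : ℕ) (b : Bool) : Multiplicative ℤ →* FreeGroup (HandleFactorGen h b) :=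
  zpowersHom _ (handleAmalgamElt h b)

/-- The amalgam `F_{2h} *_ℤ F⟨c, a, b⟩`. [cite: Baumslag1962, §4] -/
abbrev HandleAmalgam (h : ℕ) : Type := PushoutI (handleAmalgamHom h)

variable {h : ℕ}

/-- The amalgamated element of the first factor is `r_h`. [cite: LyndonSchupp2001, Ch. I §7] -/
@[simp] theorem handleAmalgamElt_false : handleAmalgamElt h false = surfaceRelator h := rfl

/-- The amalgamated element of the second factor is the letter `c`. [cite: LyndonSchupp2001, Ch. I §7] -/
@[simp] theorem handleAmalgamElt_true : handleAmalgamElt h true = FreeGroup.of none := rfl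

/-- `handleAmalgamHom h b n = (elt b) ^ n`. [cite: LyndonSchupp2001, Ch. I §7] -/
theorem handleAmalgamHom_apply (b : Bool) (n : Multiplicative ℤ) :
    handleAmalgamHom h b n = handleAmalgamElt h b ^ n.toAdd := rfl

/-- The range of each structure map is the cyclic subgroup generated by the amalgamated element.
[cite: LyndonSchupp2001, Ch. I §7] -/
theorem range_handleAmalgamHom (b : Bool) :
    (handleAmalgamHom h b).range = Subgroup.zpowers (handleAmalgamElt h b) := by
  ext x
  simp only [handleAmalgamHom, MonoidHom.mem_range, Subgroup.mem_zpowers_iff, zpowersHom_apply]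
  constructor
  · rintro ⟨n, rfl⟩; exact ⟨n.toAdd, rfl⟩
  · rintro ⟨k, rfl⟩; exact ⟨Multiplicative.ofAdd k, rfl⟩

/-- The amalgamated elements are not proper powers (`h ≥ 1`). [cite: LyndonSchupp2001, Ch. I Prop. 2.17] -/
theorem handleAmalgamElt_pow_prim (hh : 1 ≤ h) (b : Bool) (t : FreeGroup (HandleFactorGen h b)) (k : ℕ)
    (ht : t ^ k = handleAmalgamElt h b) : k = 1 := by
  cases b with
  | false => exact surfaceRelator_pow_prim hh t k ht
  | true =>
    rcases Int.natAbs_eq k with hk | hk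
    · have := FreeGroup.zpow_eq_of_iff (none : Option (surfaceGen 1)) t k (by rw [zpow_natCast]; exact ht)
      omega
    · have := FreeGroup.zpow_eq_of_iff (none : Option (surfaceGen 1)) t k (by rw [zpow_natCast]; exact ht)
      omega

/-- The amalgamated elements are non-trivial (`h ≥ 1`). [cite: LyndonSchupp2001, Ch. I §7] -/
theorem handleAmalgamElt_ne_one (hh : 1 ≤ h) (b : Bool) : handleAmalgamElt h b ≠ 1 :=
  ne_one_of_pow_prim (handleAmalgamElt_pow_prim hh b)

/-- **Injectivity** of the structure maps (`h ≥ 1`). [cite: Baumslag1962, §4] -/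
theorem handleAmalgamHom_injective (hh : 1 ≤ h) (b : Bool) :
    Function.Injective (handleAmalgamHom h b) :=
  zpowersHom_injective (handleAmalgamElt_ne_one hh b)

/-- In each factor an element outside the amalgamated `ℤ` does not commute with its generator
(`h ≥ 1`; maximal cyclic subgroups of free groups are malnormal). [cite: Baumslag1962, §4] -/
theorem handleAmalgam_commutator_ne_one (hh : 1 ≤ h) (b : Bool) (g : FreeGroup (HandleFactorGen h b))
    (hg : g ∉ (handleAmalgamHom h b).range) :
    g * handleAmalgamHom h b (Multiplicative.ofAdd 1) * g⁻¹ *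
      (handleAmalgamHom h b (Multiplicative.ofAdd 1))⁻¹ ≠ 1 := by
  intro hc
  rw [range_handleAmalgamHom] at hg
  rw [handleAmalgamHom_apply, toAdd_ofAdd, zpow_one, mul_inv_eq_one] at hc
  have hmem : g ∈ Subgroup.centralizer ({handleAmalgamElt h b ^ (1 : ℤ)} : Set _) := by
    rw [zpow_one, Subgroup.mem_centralizer_singleton_iff]
    calc g * handleAmalgamElt h b = g * handleAmalgamElt h b * g⁻¹ * g := by group
      _ = handleAmalgamElt h b * g := by rw [hc]
  rw [FreeGroup.centralizer_zpow_eq_zpowers (handleAmalgamElt_pow_prim hh b) one_ne_zero] at hmem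
  exact hg hmem

/-! ### The identification with the free group of genus `h + 1` -/

/-- The second inclusion: the last handle `F⟨a, b⟩ → F⟨c, a, b⟩ → F_{2h} *_ℤ F⟨c, a, b⟩`.
[cite: LyndonSchupp2001, Ch. I §7] -/
theorem of_true_map_some_apply (x : FreeGroup (surfaceGen 1)) :
    ((PushoutI.of (φ := handleAmalgamHom h) true).comp (FreeGroup.map some)) x =
      PushoutI.of (φ := handleAmalgamHom h) true (FreeGroup.map some x) := rfl

/-- In the amalgam, the letter `c` of the second factor equals `r_h` of the first.
[cite: LyndonSchupp2001, Ch. I §7] -/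
theorem of_true_of_none :
    (PushoutI.of (φ := handleAmalgamHom h) true (FreeGroup.of none) : HandleAmalgam h) =
      PushoutI.of (φ := handleAmalgamHom h) false (surfaceRelator h) := by
  have h1 : (FreeGroup.of none : FreeGroup (HandleFactorGen h true)) =
      handleAmalgamHom h true (Multiplicative.ofAdd 1) := by
    rw [handleAmalgamHom_apply, handleAmalgamElt_true, toAdd_ofAdd, zpow_one]
  have h0 : (surfaceRelator h : FreeGroup (HandleFactorGen h false)) =
      handleAmalgamHom h false (Multiplicative.ofAdd 1) := by
    rw [handleAmalgamHom_apply, handleAmalgamElt_false, toAdd_ofAdd, zpow_one]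
  rw [h1, h0, PushoutI.of_apply_eq_base, PushoutI.of_apply_eq_base]

/-- **`F_{2h+2} ≅ F_{2h} *_ℤ F⟨c, a, b⟩`** (`r_h = c`): an isomorphism carrying the first `h`
handles to the factor `false` and the last handle `a_{h+1}, b_{h+1}` to `a, b` in the factor
`true`. [cite: Baumslag1962, §4] -/
theorem exists_freeGroup_mulEquiv_handleAmalgam (h : ℕ) :
    ∃ e : FreeGroup (surfaceGen (h + 1)) ≃* HandleAmalgam h,
      e.toMonoidHom.comp (genInclAdd h 1) = PushoutI.of (φ := handleAmalgamHom h) false ∧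
        e.toMonoidHom.comp (genShiftAdd h 1) =
          (PushoutI.of (φ := handleAmalgamHom h) true).comp (FreeGroup.map some) := by
  refine freeGroup_exists_mulEquiv_of_coproduct (g := h) (h := 1) (Γ := HandleAmalgam h)
    (PushoutI.of (φ := handleAmalgamHom h) false)
    ((PushoutI.of (φ := handleAmalgamHom h) true).comp (FreeGroup.map some)) ?_ ?_
  · -- existence: the universal property of the pushout
    let k : Multiplicative ℤ →* FreeGroup (surfaceGen (h + 1)) :=
      zpowersHom _ (genInclAdd h 1 (surfaceRelator h))
    let fT : FreeGroup (HandleFactorGen h true) →* FreeGroup (surfaceGen (h + 1)) :=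
      FreeGroup.lift fun o => o.elim (genInclAdd h 1 (surfaceRelator h)) fun x => genShiftAdd h 1 (FreeGroup.of x)
    let f : (b : Bool) → FreeGroup (HandleFactorGen h b) →* FreeGroup (surfaceGen (h + 1)) := fun b =>
      Bool.rec (motive := fun b => FreeGroup (HandleFactorGen h b) →* FreeGroup (surfaceGen (h + 1)))
        (genInclAdd h 1) fT b
    have hf : ∀ b, (f b).comp (handleAmalgamHom h b) = k := by
      intro b
      refine MonoidHom.ext_mint ?_
      cases b with
      | false =>
        change genInclAdd h 1 (surfaceRelator h ^ Multiplicative.toAdd (Multiplicative.ofAdd (1 : ℤ))) =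
          genInclAdd h 1 (surfaceRelator h) ^ Multiplicative.toAdd (Multiplicative.ofAdd (1 : ℤ))
        rw [toAdd_ofAdd, zpow_one, zpow_one]
      | true =>
        change fT ((FreeGroup.of none) ^ Multiplicative.toAdd (Multiplicative.ofAdd (1 : ℤ))) =
          genInclAdd h 1 (surfaceRelator h) ^ Multiplicative.toAdd (Multiplicative.ofAdd (1 : ℤ))
        rw [toAdd_ofAdd, zpow_one, zpow_one]
        simp [fT]
    refine ⟨PushoutI.lift f k hf, ?_, ?_⟩
    · exact MonoidHom.ext fun x => PushoutI.lift_of f k hf (i := false) x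
    · refine FreeGroup.ext_hom _ _ fun x => ?_
      rw [MonoidHom.comp_apply, MonoidHom.comp_apply, FreeGroup.map.of, PushoutI.lift_of]
      simp [f, fT]
  · -- uniqueness
    intro F F' h₁ h₂
    refine PushoutI.hom_ext_nonempty fun b => ?_
    cases b with
    | false => exact h₁
    | true =>
      refine FreeGroup.ext_hom _ _ fun o => ?_
      cases o with
      | none =>
        rw [MonoidHom.comp_apply, MonoidHom.comp_apply, of_true_of_none]
        exact DFunLike.congr_fun h₁ (surfaceRelator h)
      | some x =>
        have := DFunLike.congr_fun h₂ (FreeGroup.of x)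
        simpa [FreeGroup.map.of] using this

end Literature.GroupTheory.CombinatorialGroupTheory
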